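import Summits.ABC.IUTFork.Joshi.DictionaryIndeterminacies
import Summits.ABC.IUTFork.Joshi.ThetaEvaluationCollation
import Summits.ABC.IUTFork.Joshi.ArithmeticoidCollation
import Summits.ABC.IUTFork.Joshi.TensorPacketsJoshiInd
import HarnessLib

/-!
# Block-E dictionary topic file D-10: Joshi's COLLATION isomorphisms ([J-III] = arXiv:2401.13508v4 Prop 9.7.5.1, p.112
# l.35–71) bound to OUR frozen (Ind1)/(Ind2) families of [IUTchIII] Thm 3.11 (i) and to the seed `Joshi/Dictionary.lean`

Dictionary-topic file of the abc-iut cell, branch E «type Joshi's construction, test vs S» (rung LADDER-ABC:A2.E; seat abc-iut-E-t18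
on FALLBACK after slot T-18; E-PLAN §3 row D-10 «collation isomorphisms (Prop 9.7.5.1, «all topological isomorphisms of H^1_e») ↦
⟨Ind1∪Ind2⟩ — second half of Y1», O-042; R14: only `Joshi/Dictionary*.lean` / `Joshi/Test*.lean` import OUR frozen `Thm311*`/`Cor312*`
decls). **No side is taken** on [IUTchIII] Cor. 3.12, on Joshi's claims, or on Mochizuki's report on them; typed ≠ proved ≠ endorsed;
Joshi's papers are unrefereed preprints. Nothing about the q- or Θ-pilots is decided here; no TEST line is filed from this file.

JOSHI SIDE (landed, imported BY NAME): E-t21's `ATS3.ClassCollationDatum C` (`Joshi/ThetaEvaluationCollation.lean`, p429631): the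
standard arithmeticoid `C.std = y₀` and, at each holomorphoid `y` and place `w`, the SET `C.iso y w` of admissible factorwise
identifications `H^1_e(arith(L′)_y, ℤ(1))_w ≃ H^1_e(arith(L′)_{y₀}, ℤ(1))_w` — «all (topological) isomorphisms … given by [Joshi, 2023a,
Proposition 7.4.1]» (p.112 l.65–70); E-t21's reading flag: print leaves open «all topological-group isomorphisms» vs «those induced
by amphoricity». The collated set `Ψ_Σ` (`C.collation`) is the ORBIT of the classes `ξ_y` under these identifications — the same
shape as the `⟨(Ind1) ∪ (Ind2)⟩`-translates S quantifies over (E-t21's structural note). The two printed readings of «which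
isomorphisms» are typed on the Joshi side by E-t38 ([ATS II½] arXiv:2305.10398 Prop 7.4.1 / 7.5.1: `ATS2half.CohomologyDatum.providedIsos`
(N, «provided by Prop 7.4.1») ⊆ `allTopIsos` (W), with the instantiations `CohomologyDatum.classCollationDatumN/W` of `C`); the two
candidate hypotheses of §2 below are their natural partners on OUR side (N ↦ `CollationInStripAut`, W ↦ `CollationInIsm` or neither).
OUR SIDE: `Thm311.LogShells` (`carrier v`, `stripAut v` = (Ind1) «automorphisms of the procession of D⊢-prime-strips» read on
`log(D⊢_v)`, `ism v` = (Ind2) «independent copies of Ism», Thm311Sig l.177 ff.), `Ind1Family` / `Ind2Family` (Thm311Multirad), the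
seed `Joshi.Dictionary S` with `MovesAreInd` / `AnsatzWithinInd` / `ansatzWithinInd_of_moves` (E-PLAN R10, p428775), and the §8.11
half `ATS3.IndDictionary` / `JMove` / `JInd2InIsm` / `JInd1InStripAut` / `prod_toPacketAut_mem_closure` (T-18, p428795 / p429226).

WHAT IS HERE (OUR READING throughout; nothing is a sentence of the paper except where a locator is given). §1 `CollationDictionary C L`:
how an admissible identification `φ ∈ C.iso y w` acts on OUR mono-analytic containers (`isoAut`, indexed by tensor factor and place —
the factor-dependent shape `factorwiseFamily` of §0, which is E-t20's `packetCongr` «factorwise ∘ summandwise» under the strictification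
D-09 (`Joshi/TensorPacketsJoshiInd.lean`); T-18's `placewiseFamily` is its factor-uniform case) and Joshi's place ↦ ours (`placeOf`). §2 the two candidate hypotheses matching the two readings print leaves open:
`CollationInStripAut` («induced by amphoricity»: each induced container automorphism is induced by an isomorphism of D⊢-prime-strips
= lies in `stripAut`, an (Ind1)-generator) and `CollationInIsm` («all topological isomorphisms» read INTO Mochizuki's (Ind2): each
lies in `Ism`); their move-wise disjunction `CollationInInd`. §3 DERIVED: under `CollationInInd` every collation move acts on the
packets through `Ind1Family ∪ Ind2Family`, hence every finite composite of §8.11 moves AND collation moves acts through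
`Subgroup.closure (Ind1Family ∪ Ind2Family)` (`prod_realise_mem_closure`). §4 GLUE TO THE SEED: `FactorsThroughBoth` (every move
of a seed dictionary — E-PLAN R10 reads `𝔈.Move` as Joshi's Ind1/Ind2/Ind3 moves AND the collation isomorphisms — is a finite
composite of §8.11 generators and collation moves) and `movesAreInd_of_factorsThroughBoth : JInd2InIsm → JInd1InStripAut →
CollationInInd → FactorsThroughBoth → Joshi.MovesAreInd`, so Y1 = `Joshi.AnsatzWithinInd` follows with the seed's other components
(`ansatzWithinInd_of_factorsThroughBoth`). Upshot for E-LOCATION §L1: for the FULL move set, the load-bearing half of Y1 reduces to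
THREE located Props of ONE shape («the container automorphism induced by a Joshi move lies in Mochizuki's (Ind1)/(Ind2) generators
at that place»): `JInd2InIsm`, `JInd1InStripAut`, `CollationInInd`. Their (−)/(+) sides are those of T-18's `Joshi/TestIndeterminacies.lean`
(pinned countermodel: `stripAut = ism = {±1}`) and X-07′ (E-t32). [claim: Joshi2024ATS3, status: disputed]; our side
[claim: Mochizuki2012, status: disputed]. Standard axioms; no instance, no notation, no new `Prop` fact.
-/

noncomputable section

namespace Summit.ABC.IUTFork.Joshi.ATS3

open Function Set Thm311

universe u v w

variable {T : ThetaIndex}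

/-! ## 0. Factor-dependent place-indexed families (the shape of E-t20's `packetCongr` under the strictification D-09) -/

/-- The packet-automorphism family acting on the tensor factor `i ∈ S^±_{j+1}` and the summand `v` by a chosen automorphism `g j i v`
of `log(D⊢_v)` — factor by factor, summand by summand (our `LogShells.factorwise ∘ summandwise`; this is the shape of E-t20's
`packetCongr` «= L.factorwise j p (a ↦ L.summandwise p (w ↦ g_{z_a,w}))», `Joshi/TensorPacketsJoshiInd.lean`, by which Rmk 9.4.8.2's
amphoric identifications and Prop 9.7.5.1's collation act on Mochizuki's packets). T-18's `placewiseFamily` is the factor-uniform case.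
[folklore] -/
def factorwiseFamily (L : LogShells T) (g : ∀ j : T.Label, T.Caps j → ∀ v : T.V, L.carrier v ≃ₗ[ℚ] L.carrier v) :
    L.PacketAut :=
  fun j vQ => L.factorwise j vQ fun i => L.summandwise vQ fun v => g j i v.1

/-- A factor-dependent family of `Ism`-elements is an (Ind2)-family ([IUTchIII] Thm 3.11 (i) (Ind2) «independent copies of Ism on each
of the direct summands of the j+1 factors» — independence over factors AND summands is exactly what `LogShells.Ind2` allows).
[claim: Mochizuki2012, status: disputed] -/
theorem factorwiseFamily_mem_Ind2Family (L : LogShells T)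
    {g : ∀ j : T.Label, T.Caps j → ∀ v : T.V, L.carrier v ≃ₗ[ℚ] L.carrier v} (hg : ∀ j i v, g j i v ∈ L.ism v) :
    factorwiseFamily L g ∈ L.Ind2Family :=
  fun j _ => ⟨fun i v => g j i v.1, fun i v => hg j i v.1, rfl⟩

/-- A factor-dependent family of strip-automorphisms is an (Ind1)-family (identity permutation of the capsule; [IUTchIII] Thm 3.11 (i)
(Ind1): independent strip-automorphisms per factor and place). [claim: Mochizuki2012, status: disputed] -/
theorem factorwiseFamily_mem_Ind1Family (L : LogShells T)
    {g : ∀ j : T.Label, T.Caps j → ∀ v : T.V, L.carrier v ≃ₗ[ℚ] L.carrier v} (hg : ∀ j i v, g j i v ∈ L.stripAut v) :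
    factorwiseFamily L g ∈ L.Ind1Family := fun j =>
  ⟨Equiv.refl _, fun i v => g j i v, fun i v => hg j i v, fun vQ => by
    rw [L.permute_refl]
    rfl⟩

/-- T-18's factor-uniform `placewiseFamily` is the factorwise family with the same automorphism on every factor. [folklore] -/
theorem placewiseFamily_eq_factorwiseFamily (L : LogShells T) (g : ∀ v : T.V, L.carrier v ≃ₗ[ℚ] L.carrier v) :
    placewiseFamily L g = factorwiseFamily L (fun _ _ v => g v) := rfl

/-! ## 1. The collation dictionary (DATA only) -/

/-- **`CollationDictionary` — OUR READING of how Joshi's collation isomorphisms act on the mono-analytic containers** (dictionary row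
D-10). For E-t21's collation datum `C` ([J-III] Prop 9.7.5.1, p.112 l.35–71) and OUR log-shell signature `L`: `placeOf` sends a place
`w` of `L′` to our `v ∈ V` (D-01); `isoAut y w φ j i w′` is the linear automorphism of OUR container `log(D⊢_{w′})` by which the
admissible identification `φ : H^1_e(arith(L′)_y)_w ≃ H^1_e(arith(L′)_{y₀})_w` acts on the summand `w′` of the tensor FACTOR `i ∈ S^±_{j+1}`
of the label-`j` packet (at `w′ = placeOf w` and on the factors carrying the holomorphoid `y` — reading R1 of E-t21 = all factors,
reading R2 = slot by slot; identity elsewhere: the dictionary decides, print does not). DATA only; every claimed compatibility is a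
separate `Prop` below. [claim: Joshi2024ATS3, status: disputed] -/
structure CollationDictionary {Y : Type u} {V : Type v} {H : Y → V → Type w} (C : ClassCollationDatum Y V H)
    (L : LogShells T) where
  /-- D-01: a place `w` of `L′` ↦ our `v ∈ V` -/
  placeOf : V → T.V
  /-- D-10: the container automorphisms, per tensor factor and place, induced by an admissible identification `φ ∈ C.iso y w` -/
  isoAut : ∀ (y : Y) (w : V), ↥(C.iso y w) → ∀ j : T.Label, T.Caps j → ∀ w' : T.V, L.carrier w' ≃ₗ[ℚ] L.carrier w'

/-- **A collation move**: an admissible identification `φ ∈ C.iso y w` at some holomorphoid `y` and place `w` (the generators of the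
orbit `Ψ_Σ = C.collation`, [J-III] Prop 9.7.5.1). [claim: Joshi2024ATS3, status: disputed] -/
def CollationMove {Y : Type u} {V : Type v} {H : Y → V → Type w} (C : ClassCollationDatum Y V H) : Type (max u v w) :=
  Σ y : Y, Σ w : V, ↥(C.iso y w)

namespace CollationDictionary

variable {Y : Type u} {V : Type v} {H : Y → V → Type w} {C : ClassCollationDatum Y V H} {L : LogShells T}
  (𝔠 : CollationDictionary C L)

/-- The packet-automorphism family by which a collation move acts on Mochizuki's tensor packets, through the dictionary (the
factor-dependent `factorwiseFamily` of §0). [claim: Joshi2024ATS3, status: disputed] -/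
def toPacketAut : CollationMove C → L.PacketAut
  | ⟨y, w, φ⟩ => factorwiseFamily L (𝔠.isoAut y w φ)

/-! ## 2. The candidate hypotheses (the two readings print leaves open, and their move-wise disjunction) -/

/-- **`CollationInStripAut` (OUR READING of «isomorphisms … given by [Joshi, 2023a, Proposition 7.4.1]» = induced by amphoricity)**:
every container automorphism induced by an admissible collation identification is induced by an isomorphism of D⊢-prime-strips
(our `LogShells.stripAut`, the (Ind1) generator at a place). Candidate hypothesis; never asserted. [claim: Joshi2024ATS3, status: disputed] -/
def CollationInStripAut : Prop :=
  ∀ (y : Y) (w : V) (φ : ↥(C.iso y w)) (j : T.Label) (i : T.Caps j) (w' : T.V), 𝔠.isoAut y w φ j i w' ∈ L.stripAut w'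

/-- **`CollationInIsm` (OUR READING of «all (topological) isomorphisms» INTO Mochizuki's (Ind2))**: every container automorphism induced
by an admissible collation identification lies in `Ism` at that place (our `LogShells.ism`). Candidate hypothesis; never asserted.
[claim: Joshi2024ATS3, status: disputed] -/
def CollationInIsm : Prop :=
  ∀ (y : Y) (w : V) (φ : ↥(C.iso y w)) (j : T.Label) (i : T.Caps j) (w' : T.V), 𝔠.isoAut y w φ j i w' ∈ L.ism w'

/-- **`CollationInInd`**: move by move, the induced container automorphisms are (Ind1)-generators at every place OR (Ind2)-generators at
every place — the weakest hypothesis under which a collation move is realised inside `Ind1Family ∪ Ind2Family`. Candidate hypothesis.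
[claim: Joshi2024ATS3, status: disputed] -/
def CollationInInd : Prop :=
  ∀ (y : Y) (w : V) (φ : ↥(C.iso y w)),
    (∀ (j : T.Label) (i : T.Caps j) (w' : T.V), 𝔠.isoAut y w φ j i w' ∈ L.stripAut w') ∨
      (∀ (j : T.Label) (i : T.Caps j) (w' : T.V), 𝔠.isoAut y w φ j i w' ∈ L.ism w')

/-- The amphoricity reading implies the disjunctive form. [folklore] -/
theorem collationInInd_of_stripAut (h : 𝔠.CollationInStripAut) : 𝔠.CollationInInd := fun y w φ => Or.inl (h y w φ)

/-- The Ism reading implies the disjunctive form. [folklore] -/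
theorem collationInInd_of_ism (h : 𝔠.CollationInIsm) : 𝔠.CollationInInd := fun y w φ => Or.inr (h y w φ)

/-! ## 3. Collation moves act through the indeterminacy subgroup (under the candidate hypotheses) -/

/-- Under `CollationInInd` every collation move acts on the packets through `Ind1Family ∪ Ind2Family` (§0's
`factorwiseFamily_mem_Ind1Family` / `_mem_Ind2Family`). DERIVED. [claim: Mochizuki2012, status: disputed] -/
theorem toPacketAut_mem_union (h : 𝔠.CollationInInd) (κ : CollationMove C) :
    𝔠.toPacketAut κ ∈ L.Ind1Family ∪ L.Ind2Family := by
  obtain ⟨y, w, φ⟩ := κ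
  rcases h y w φ with h1 | h2
  · exact Or.inl (factorwiseFamily_mem_Ind1Family L h1)
  · exact Or.inr (factorwiseFamily_mem_Ind2Family L h2)

/-- Hence a single collation move lands in `Subgroup.closure (Ind1Family ∪ Ind2Family)`. [claim: Mochizuki2012, status: disputed] -/
theorem toPacketAut_mem_closure (h : 𝔠.CollationInInd) (κ : CollationMove C) :
    𝔠.toPacketAut κ ∈ Subgroup.closure (L.Ind1Family ∪ L.Ind2Family) :=
  Subgroup.subset_closure (𝔠.toPacketAut_mem_union h κ)

variable {𝔍 : RosettaIndDatum} (𝔇' : IndDictionary 𝔍 L)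

/-- **A full Joshi move**: a §8.11 generator (Ind2 element `σ` or anabelomorph `E′`, T-18's `JMove`) or a collation move. (Ind3 moves
shift the column index only, D-07.) [claim: Joshi2024ATS3, status: disputed] -/
def FullMove (𝔍 : RosettaIndDatum) (C : ClassCollationDatum Y V H) : Type (max u v w) :=
  IndDictionary.JMove 𝔍 ⊕ CollationMove C

/-- Realisation of a full move on the packets through the two dictionaries. [claim: Joshi2024ATS3, status: disputed] -/
def realise : FullMove 𝔍 C → L.PacketAut :=
  Sum.elim 𝔇'.toPacketAut 𝔠.toPacketAut

/-- Under the three candidate hypotheses every full move acts through `Ind1Family ∪ Ind2Family`. DERIVED. [claim: Mochizuki2012, status: disputed] -/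
theorem realise_mem_union (h2 : 𝔇'.JInd2InIsm) (h1 : 𝔇'.JInd1InStripAut) (hc : 𝔠.CollationInInd) (m : FullMove 𝔍 C) :
    𝔠.realise 𝔇' m ∈ L.Ind1Family ∪ L.Ind2Family := by
  cases m with
  | inl μ => exact 𝔇'.toPacketAut_mem_union h2 h1 μ
  | inr κ => exact 𝔠.toPacketAut_mem_union hc κ

/-- **Closure theorem for the full move set**: under `JInd2InIsm ∧ JInd1InStripAut ∧ CollationInInd` every finite composite of §8.11
moves and collation moves acts on Mochizuki's tensor packets through `Subgroup.closure (L.Ind1Family ∪ L.Ind2Family)`. DERIVED.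
[claim: Mochizuki2012, status: disputed] -/
theorem prod_realise_mem_closure (h2 : 𝔇'.JInd2InIsm) (h1 : 𝔇'.JInd1InStripAut) (hc : 𝔠.CollationInInd)
    (l : List (FullMove 𝔍 C)) :
    (l.map (𝔠.realise 𝔇')).prod ∈ Subgroup.closure (L.Ind1Family ∪ L.Ind2Family) := by
  refine list_prod_mem fun Φ hΦ => ?_
  obtain ⟨m, -, rfl⟩ := List.mem_map.1 hΦ
  exact Subgroup.subset_closure (𝔠.realise_mem_union 𝔇' h2 h1 hc m)

end CollationDictionary

/-! ## 4. Glue to the seed dictionary `Joshi.Dictionary S` (E-PLAN R10): `MovesAreInd` and Y1 for the FULL move set -/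

namespace CollationDictionary

variable {S : LatticeSituation T} {Y : Type u} {V : Type v} {H : Y → V → Type w} {C : ClassCollationDatum Y V H}
  (𝔠 : CollationDictionary C S.L) {𝔍 : RosettaIndDatum} (𝔇' : IndDictionary 𝔍 S.L) (𝔈 : Joshi.Dictionary S)

/-- **`FactorsThroughBoth`** (OUR READING, relating the dictionaries): every move of the seed dictionary `𝔈` — Joshi's Ind1/Ind2/Ind3
moves and the collation isomorphisms of Prop 9.7.5.1, as E-PLAN R10 reads `𝔈.Move` — is realised on the packets as a finite composite
of §8.11 generators and collation moves through the two dictionaries. Candidate hypothesis; never asserted. [claim: Joshi2024ATS3, status: disputed] -/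
def FactorsThroughBoth : Prop :=
  ∀ g : 𝔈.Move, ∃ l : List (FullMove 𝔍 C), 𝔈.real g = (l.map (𝔠.realise 𝔇')).prod

/-- A seed dictionary that factors through the §8.11 moves alone (T-18's `FactorsThrough`) factors through both. [folklore] -/
theorem factorsThroughBoth_of_factorsThrough (hf : 𝔇'.FactorsThrough 𝔈) : 𝔠.FactorsThroughBoth 𝔇' 𝔈 := fun g => by
  obtain ⟨l, hl⟩ := hf g
  refine ⟨l.map Sum.inl, ?_⟩
  rw [hl, List.map_map]
  rfl

/-- **The load-bearing half of Y1 for the FULL move set**: `JInd2InIsm ∧ JInd1InStripAut ∧ CollationInInd ∧ FactorsThroughBoth ⟹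
Joshi.MovesAreInd`. Kernel glue only. [claim: Mochizuki2012, status: disputed] -/
theorem movesAreInd_of_factorsThroughBoth (h2 : 𝔇'.JInd2InIsm) (h1 : 𝔇'.JInd1InStripAut) (hc : 𝔠.CollationInInd)
    (hf : 𝔠.FactorsThroughBoth 𝔇' 𝔈) : Joshi.MovesAreInd 𝔈 := fun g => by
  obtain ⟨l, hl⟩ := hf g
  rw [hl]
  exact 𝔠.prod_realise_mem_closure 𝔇' h2 h1 hc l

/-- **Y1 `Joshi.AnsatzWithinInd` for the full move set**: the seed's `BaseIsThetaPilot ∧ DatumEquivariant ∧ StdReachable` + the three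
located Props + `FactorsThroughBoth` ⟹ Y1 (via the seed's `ansatzWithinInd_of_moves`). Kernel glue; S is NOT concluded here (that needs
the seed's `StandardPointIsQPilot`, STRONGER-THAN-PRINT, E-PLAN R15 — a Test-file matter). [claim: Joshi2024ATS3, status: disputed] -/
theorem ansatzWithinInd_of_factorsThroughBoth {P : Cor312.Setting S.toSituation}
    (ρ : (∀ v : T.V, v ∈ T.Vbad → Set (S.L.StarPacket v)) → ∀ (j : T.Label) (vQ : T.VQ), Set (S.L.Packet j vQ))
    (hB : Joshi.BaseIsThetaPilot 𝔈 (P := P)) (hE : Joshi.DatumEquivariant 𝔈) (hR : Joshi.StdReachable 𝔈)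
    (h2 : 𝔇'.JInd2InIsm) (h1 : 𝔇'.JInd1InStripAut) (hc : 𝔠.CollationInInd) (hf : 𝔠.FactorsThroughBoth 𝔇' 𝔈) :
    Joshi.AnsatzWithinInd ρ 𝔈 (P := P) :=
  Joshi.ansatzWithinInd_of_moves ρ 𝔈 hB (𝔠.movesAreInd_of_factorsThroughBoth 𝔇' 𝔈 h2 h1 hc hf) hE hR

/-- The trivial collation dictionary (every identification acts as the identity on our containers) satisfies both readings —
NON-VACUITY in the weak sense only; whether a CONTENTFUL dictionary does is the branch-E test question. [folklore] -/
theorem trivial_satisfies (placeOf : V → T.V) :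
    (⟨placeOf, fun _ _ _ _ _ w' => LinearEquiv.refl ℚ (S.L.carrier w')⟩ : CollationDictionary C S.L).CollationInStripAut ∧
      (⟨placeOf, fun _ _ _ _ _ w' => LinearEquiv.refl ℚ (S.L.carrier w')⟩ : CollationDictionary C S.L).CollationInIsm :=
  ⟨fun _ _ _ _ _ w' => S.L.one_mem_stripAut w', fun _ _ _ _ _ w' => S.L.one_mem_ism w'⟩

end CollationDictionary

/-! ## 5. Monotonicity in the admissible identifications (readings N ⊆ W) and the junction with E-t38's N/W data (appended) -/

/-- A collation datum with the same standard arithmeticoid and FEWER admissible identifications (a sub-family `iso ⊆ C'.iso`; e.g.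
E-t38's reading N = «provided by [ATS II½] Prop 7.4.1» inside reading W = «all topological isomorphisms»,
`ATS2half.CohomologyDatum.providedIsos_subset_allTopIsos`). DATA. [claim: Joshi2024ATS3, status: disputed] -/
def _root_.Summit.ABC.IUTFork.Joshi.ATS3.ClassCollationDatum.sub {Y : Type u} {V : Type v} {H : Y → V → Type w}
    (C' : ClassCollationDatum Y V H) (iso : ∀ (y : Y) (w : V), Set (H y w ≃ H C'.std w))
    (_hsub : ∀ y w, iso y w ⊆ C'.iso y w) : ClassCollationDatum Y V H :=
  ⟨C'.std, iso⟩

namespace CollationDictionary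

variable {Y : Type u} {V : Type v} {H : Y → V → Type w} {C' : ClassCollationDatum Y V H} {L : LogShells T}
  (𝔠' : CollationDictionary C' L) {iso : ∀ (y : Y) (w : V), Set (H y w ≃ H C'.std w)} (hsub : ∀ y w, iso y w ⊆ C'.iso y w)

/-- **Restriction of a collation dictionary to a sub-family of admissible identifications** (a dictionary for the wide reading gives
one for the narrow reading). DATA. [claim: Joshi2024ATS3, status: disputed] -/
def restrict : CollationDictionary (C'.sub iso hsub) L where
  placeOf := 𝔠'.placeOf
  isoAut y w φ := 𝔠'.isoAut y w ⟨φ.1, hsub y w φ.2⟩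

/-- The Ism reading is inherited by restriction (a hypothesis granted for the wide reading holds for the narrow one). [folklore] -/
theorem collationInIsm_restrict (h : 𝔠'.CollationInIsm) : (𝔠'.restrict hsub).CollationInIsm :=
  fun y w φ j i w' => h y w ⟨φ.1, hsub y w φ.2⟩ j i w'

/-- The strip-automorphism (amphoricity) reading is inherited by restriction. [folklore] -/
theorem collationInStripAut_restrict (h : 𝔠'.CollationInStripAut) : (𝔠'.restrict hsub).CollationInStripAut :=
  fun y w φ j i w' => h y w ⟨φ.1, hsub y w φ.2⟩ j i w'

/-- The disjunctive reading is inherited by restriction. [folklore] -/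
theorem collationInInd_restrict (h : 𝔠'.CollationInInd) : (𝔠'.restrict hsub).CollationInInd :=
  fun y w φ => h y w ⟨φ.1, hsub y w φ.2⟩

end CollationDictionary

/-! ### The junction with [ATS II½] Prop 7.4.1 / 7.5.1 as typed by E-t38 (`Joshi/ArithmeticoidCollation.lean`) -/

section ATS2halfJunction

open ATS2half

variable {V₀ : Type u} {Pt : V₀ → Type u} {H₀ : ℕ → (v : V₀) → Pt v → Type u} [∀ i v y, CommGroup (H₀ i v y)]
  [∀ i v y, TopologicalSpace (H₀ i v y)] {IsArc : Set V₀} {G₀ : (v : V₀) → Pt v → Type u} [∀ v y, Group (G₀ v y)]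
  [∀ v y, TopologicalSpace (G₀ v y)] {L : LogShells T}

/-- E-t38's N-datum IS the sub-datum of its W-datum cut out by the provided isomorphisms (definitional). [claim: Joshi2023ATS2half, status: disputed] -/
theorem classCollationDatumN_eq_sub (𝔠 : CohomologyDatum H₀ IsArc G₀) (i : ℕ) :
    𝔠.classCollationDatumN i =
      (𝔠.classCollationDatumW i).sub (fun y w => 𝔠.providedIsos i w (y w) (𝔠.std w))
        (fun y w => 𝔠.providedIsos_subset_allTopIsos i w (y w) (𝔠.std w)) :=
  rfl

/-- **Reading W restricts to reading N on OUR side**: a collation dictionary for E-t38's W-datum (`classCollationDatumW`: all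
topological-group isomorphisms of each factor, [ATS II½] Prop 7.5.1 read widely) restricts to one for the N-datum (`classCollationDatumN`:
the isomorphisms «provided by Prop 7.4.1»), by `providedIsos_subset_allTopIsos` — the kernel junction of D-10 with [ATS II½] §7 (carriers
and universe levels fit). DATA. [claim: Joshi2023ATS2half, status: disputed] -/
def CollationDictionary.restrictNW (𝔠 : CohomologyDatum H₀ IsArc G₀) (i : ℕ)
    (𝔠W : CollationDictionary (𝔠.classCollationDatumW i) L) : CollationDictionary (𝔠.classCollationDatumN i) L :=
  𝔠W.restrict fun y w => 𝔠.providedIsos_subset_allTopIsos i w (y w) (𝔠.std w)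

/-- Hence the disjunctive candidate hypothesis, once granted for the W-reading, holds for the N-reading. [folklore] -/
theorem CollationDictionary.collationInInd_restrictNW (𝔠 : CohomologyDatum H₀ IsArc G₀) (i : ℕ)
    (𝔠W : CollationDictionary (𝔠.classCollationDatumW i) L) (h : 𝔠W.CollationInInd) :
    (CollationDictionary.restrictNW 𝔠 i 𝔠W).CollationInInd :=
  𝔠W.collationInInd_restrict _ h

/-- … and likewise the Ism reading. [folklore] -/
theorem CollationDictionary.collationInIsm_restrictNW (𝔠 : CohomologyDatum H₀ IsArc G₀) (i : ℕ)
    (𝔠W : CollationDictionary (𝔠.classCollationDatumW i) L) (h : 𝔠W.CollationInIsm) :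
    (CollationDictionary.restrictNW 𝔠 i 𝔠W).CollationInIsm :=
  𝔠W.collationInIsm_restrict _ h

end ATS2halfJunction

/-! ### The junction with E-t20's §9.4 realisation (D-09, `Joshi/TensorPacketsJoshiInd.lean`): `strictMove` IS a `factorwiseFamily` (appended) -/

section TensorPacketJunction

/-- **One shape.** E-t20's strict move along a tuple `z` of arithmeticoids by local carrier isomorphisms `g_{y,w}` ([J-III] §9.4, Rmk 9.4.8.2 /
Prop 9.7.5.1 read on the tensor-packet codomain under the strictification D-09; `TensorPacketDatum.strictMove`) IS the factor-dependent family
`factorwiseFamily` of §0 with `g j i v := g_{z_{(j,i)}, v}` — definitionally. So D-09's realisation, D-10's `CollationDictionary.toPacketAut` and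
T-18's `placewiseFamily` are ONE construction, and E-t20's `LocalIsosInInd`-route to `MovesAreInd` (`DictionaryTensorPackets`) and the
`CollationInInd` / `JMovesInInd` routes here quantify over the same generators. [folklore] -/
theorem strictMove_eq_factorwiseFamily (𝔗 : TensorPacketDatum T) (L : LogShells T)
    (g : 𝔗.Arith → ∀ w : T.V, L.carrier w ≃ₗ[ℚ] L.carrier w) (z : T.Label → 𝔗.Arith) :
    𝔗.strictMove L g z = factorwiseFamily L fun j i v => g (𝔗.capsEntry z j i) v := rfl

/-- Hence E-t20's sufficient condition and §0's agree: local isomorphisms all in `Ism` (resp. all in `stripAut`) give an (Ind2)- (resp.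
(Ind1)-) family — the same proof obligation seen from either file. [folklore] -/
theorem strictMove_mem_Ind2Family_iff_factorwise (𝔗 : TensorPacketDatum T) (L : LogShells T)
    (g : 𝔗.Arith → ∀ w : T.V, L.carrier w ≃ₗ[ℚ] L.carrier w) (z : T.Label → 𝔗.Arith) :
    𝔗.strictMove L g z ∈ L.Ind2Family ↔ (factorwiseFamily L fun j i v => g (𝔗.capsEntry z j i) v) ∈ L.Ind2Family := Iff.rfl

end TensorPacketJunction

end Summit.ABC.IUTFork.Joshi.ATS3

end
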